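import Summits.HubbardSuperconductivity.HubbardSuperconductivity.Theorems.MesoscopicPairOrder.Negative.NoSaturationWindowBoxes
import Mathlib.Analysis.SpecialFunctions.Trigonometric.Bounds
import Mathlib.Analysis.Real.Pi.Bounds

/-!
# Crux `MesoscopicPairOrder` (item `stmt-HubbardSuperconductivity-7331`): the single-flip envelope and
# the full box `[0, 6] × [1/10, 3/10]` free of saturated ferromagnetism

Negative-side support (lead c7, line `pointwise_split`), fourth file of the no-saturation thread
(`SingleSpinFlip` → `NoSaturationWindow` → `NoSaturationWindowBoxes` → this file).

* `not_frequently_saturated_of_lt_envelope` — the diamond-count single-flip criterion in CLOSED FORM: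
  for `0 ≤ U`, `δ ∈ (0, 1/2)` and `U (1 - δ) < 4 + 4cos²(π√(δ/2))`, saturated `(N_L, S^z = 0)`-sector
  ground states of `hubbardTorus 2 L 1 U` do NOT occur along infinitely many even sides (the angle
  `θ ↘ √(δ/2)` of `not_frequently_saturated`, by continuity of `cos²`). The envelope
  `δ ↦ 4 + 4cos²(π√(δ/2))` decreases from `8` (`δ ↘ 0`) to `4` (`δ ↗ 1/2`); it is `≈ 5.04` at `δ = 1/5`
  (so `U < 6.3`) and `≈ 4.86` at `δ = 6/25`.
* `cos_sq_pi_mul_seven_div_twenty_ge` — `19/100 ≤ cos²(7π/20)` (`cos(7π/20) = sin(3π/20) > y - y³/6`,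
  `y = 3π/20 ∈ (0.471, 0.4725)`).
* `not_frequently_saturated_window_six` — the whole box `0 ≤ U ≤ 6`, `δ ∈ [1/10, 3/10]`: the sliver
  `(57/10, 6] × [2/9, 6/25)` left open by `NoSaturationWindowBoxes` is closed with the angle `θ = 7/20`
  (`δ < 2θ² = 49/200`, threshold `4 + 4·19/100 = 4.76 > 6·7/9`).
* `not_frequently_saturated_route_box` — in particular on the route's whole target box
  `[4, 6] × [3/20, 1/4]` (and at its primary point `(4, 1/6)`) the hypothesis of
  `Negative/SaturatedExclusion.pointwise_false_of_saturated` is false: a witness `(U, δ)` of the crux taken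
  there is automatically clear of the Nagaoka hazard, with no sliver left.

Nothing here proves or refutes the crux. Sources: H. Tasaki, Prog. Theor. Phys. 99 (1998) 489, Thm 3.2
(single spin flip); folklore trigonometry. No definition, no named fact.
-/

noncomputable section

-- the summit namespace repeats the problem name by design (D-0017)
set_option linter.dupNamespace false

namespace Summit.HubbardSuperconductivity.HubbardSuperconductivity.Theorems.MesoscopicPairOrder.Negative

open Matrix Finset Filter
open Literature.Probability.LatticeModels Literature.MathematicalPhysics.QuantumLattice
open scoped ComplexOrder ComplexConjugate Topology

/-! ### The envelope `U(1-δ) < 4 + 4cos²(π√(δ/2))` -/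

/-- **Single-flip envelope.** For `0 ≤ U`, `δ ∈ (0, 1/2)` and `U (1 - δ) < 4 + 4cos²(π√(δ/2))`,
saturated `(N_L, S^z = 0)`-sector ground states do not occur along infinitely many even sides: by
continuity of `θ ↦ 4cos²(πθ)` at `θ₀ = √(δ/2) < 1/2` there is an angle `θ ∈ (θ₀, 1/2)` with
`δ = 2θ₀² < 2θ²` and `U(1-δ) < 4 + 4cos²(πθ)`, and `not_frequently_saturated` applies. [folklore] -/
theorem not_frequently_saturated_of_lt_envelope {U δ : ℝ} (hU0 : 0 ≤ U)
    (hδ : δ ∈ Set.Ioo (0 : ℝ) (1 / 2))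
    (hU : U * (1 - δ) < 4 + 4 * Real.cos (Real.pi * Real.sqrt (δ / 2)) ^ 2) :
    ¬ ∃ᶠ L : ℕ in atTop, Even L ∧ ∃ ψ : Fock (Orb (FermionTorus 2 L)),
      IsGroundStateInSector (hubbardTorus 2 L 1 U) (2 * ⌊(1 - δ) * (L : ℝ) ^ 2 / 2⌋₊) 0 ψ ∧
        spinSq *ᵥ ψ = (((⌊(1 - δ) * (L : ℝ) ^ 2 / 2⌋₊ : ℝ) *
          ((⌊(1 - δ) * (L : ℝ) ^ 2 / 2⌋₊ : ℝ) + 1) : ℝ) : ℂ) • ψ := by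
  set θ₀ : ℝ := Real.sqrt (δ / 2) with hθ₀
  have hθ₀lt : θ₀ < 1 / 2 := by
    rw [hθ₀, Real.sqrt_lt' (by norm_num)]
    linarith [hδ.2]
  have hθ₀nn : 0 ≤ θ₀ := Real.sqrt_nonneg _
  have hsq : θ₀ ^ 2 = δ / 2 := Real.sq_sqrt (by linarith [hδ.1])
  have hcont : ContinuousAt (fun x : ℝ => 4 + 4 * Real.cos (Real.pi * x) ^ 2) θ₀ :=
    (by fun_prop : Continuous fun x : ℝ => 4 + 4 * Real.cos (Real.pi * x) ^ 2).continuousAt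
  have e1 : ∀ᶠ θ in 𝓝[>] θ₀, U * (1 - δ) < 4 + 4 * Real.cos (Real.pi * θ) ^ 2 :=
    (hcont.eventually_const_lt hU).filter_mono nhdsWithin_le_nhds
  have e2 : ∀ᶠ θ in 𝓝[>] θ₀, θ ∈ Set.Ioo θ₀ (1 / 2) := Ioo_mem_nhdsGT hθ₀lt
  obtain ⟨θ, hUθ, hθgt, hθlt⟩ := (e1.and e2).exists
  have hθ0 : 0 < θ := lt_of_le_of_lt hθ₀nn hθgt
  have hδθ : δ < 2 * θ ^ 2 := by nlinarith
  exact not_frequently_saturated hU0 hδ.1 hδθ hθ0 hθlt hUθ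

/-! ### The sliver angle `θ = 7/20` -/

/-- `19/100 ≤ cos²(7π/20)` (`cos(7π/20) = sin(3π/20)`, `sin y > y - y³/6`, `3.14 < π < 3.15`).
[folklore] -/
theorem cos_sq_pi_mul_seven_div_twenty_ge : (19 / 100 : ℝ) ≤ Real.cos (Real.pi * (7 / 20)) ^ 2 := by
  rw [show Real.pi * (7 / 20) = Real.pi / 2 - Real.pi * (3 / 20) by ring, Real.cos_pi_div_two_sub]
  have hπ1 := Real.pi_gt_d2
  have hπ2 := Real.pi_lt_d2
  have hy0 : (0.471 : ℝ) < Real.pi * (3 / 20) := by linarith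
  have hy1 : Real.pi * (3 / 20) < (0.4725 : ℝ) := by linarith
  have hs := Real.sin_gt_sub_cube (x := Real.pi * (3 / 20)) (by linarith)
  have hy3 : (Real.pi * (3 / 20)) ^ 3 < (0.4725 : ℝ) ^ 3 :=
    pow_lt_pow_left₀ hy1 (by linarith) (by norm_num)
  have hc : (0.4725 : ℝ) ^ 3 < 0.1055 := by norm_num
  have hlow : (0.4448 : ℝ) < Real.pi * (3 / 20) - (Real.pi * (3 / 20)) ^ 3 / 6 := by linarith
  have hsin : (0.4448 : ℝ) < Real.sin (Real.pi * (3 / 20)) := lt_trans hlow hs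
  have hsin0 : 0 < Real.sin (Real.pi * (3 / 20)) := by linarith
  nlinarith

/-! ### The full box `[0, 6] × [1/10, 3/10]` and the route's target box -/

/-- **No saturated ferromagnetism on `[0, 6] × [1/10, 3/10]`** (along even sides, i.o.-negated form):
`δ < 2/9` by `not_frequently_saturated_window_six_low`, `δ ≥ 6/25` by `…_six_high`, and the sliver
`2/9 ≤ δ < 6/25` by the angle `θ = 7/20` (`2θ² = 49/200 > 6/25`, `U(1-δ) ≤ 6·7/9 = 14/3 < 4.76`).
[folklore] -/
theorem not_frequently_saturated_window_six {U δ : ℝ} (hU0 : 0 ≤ U) (hU : U ≤ 6)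
    (hδ : δ ∈ Set.Icc (1 / 10 : ℝ) (3 / 10)) :
    ¬ ∃ᶠ L : ℕ in atTop, Even L ∧ ∃ ψ : Fock (Orb (FermionTorus 2 L)),
      IsGroundStateInSector (hubbardTorus 2 L 1 U) (2 * ⌊(1 - δ) * (L : ℝ) ^ 2 / 2⌋₊) 0 ψ ∧
        spinSq *ᵥ ψ = (((⌊(1 - δ) * (L : ℝ) ^ 2 / 2⌋₊ : ℝ) *
          ((⌊(1 - δ) * (L : ℝ) ^ 2 / 2⌋₊ : ℝ) + 1) : ℝ) : ℂ) • ψ := by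
  obtain ⟨hδ1, hδ2⟩ := hδ
  rcases lt_or_ge δ (2 / 9) with hA | hA
  · exact not_frequently_saturated_window_six_low hU0 hU ⟨hδ1, hA⟩
  rcases lt_or_ge δ (6 / 25) with hB | hB
  · have hδ0 : 0 < δ := by linarith
    have h1δ : 0 ≤ 1 - δ := by linarith
    have hprod : U * (1 - δ) ≤ 6 * (1 - δ) := mul_le_mul_of_nonneg_right hU h1δ
    exact not_frequently_saturated_of_cos_sq_ge (θ := 7 / 20) (c := 19 / 100) hU0 hδ0 (by nlinarith)
      (by norm_num) (by norm_num) cos_sq_pi_mul_seven_div_twenty_ge (by nlinarith)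
  · exact not_frequently_saturated_window_six_high hU0 hU ⟨hB, hδ2⟩

/-- **The route's target box is clear of the Nagaoka hazard**: for `U ∈ [4, 6]`, `δ ∈ [3/20, 1/4]`
(the window of route `FunctionFieldCertificate`, containing its primary point `(4, 1/6)`), saturated
`(N_L, S^z = 0)`-sector ground states do not occur along infinitely many even sides, so
`Negative/SaturatedExclusion.pointwise_false_of_saturated` cannot fire anywhere on the box. [folklore] -/
theorem not_frequently_saturated_route_box {U δ : ℝ} (hU : U ∈ Set.Icc (4 : ℝ) 6)
    (hδ : δ ∈ Set.Icc (3 / 20 : ℝ) (1 / 4)) :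
    ¬ ∃ᶠ L : ℕ in atTop, Even L ∧ ∃ ψ : Fock (Orb (FermionTorus 2 L)),
      IsGroundStateInSector (hubbardTorus 2 L 1 U) (2 * ⌊(1 - δ) * (L : ℝ) ^ 2 / 2⌋₊) 0 ψ ∧
        spinSq *ᵥ ψ = (((⌊(1 - δ) * (L : ℝ) ^ 2 / 2⌋₊ : ℝ) *
          ((⌊(1 - δ) * (L : ℝ) ^ 2 / 2⌋₊ : ℝ) + 1) : ℝ) : ℂ) • ψ :=
  not_frequently_saturated_window_six (by linarith [hU.1]) hU.2 ⟨by linarith [hδ.1], by linarith [hδ.2]⟩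

/-- Pointwise form at the route's primary window point `(U, δ) = (4, 1/6)`. [folklore] -/
theorem not_frequently_saturated_four_sixth :
    ¬ ∃ᶠ L : ℕ in atTop, Even L ∧ ∃ ψ : Fock (Orb (FermionTorus 2 L)),
      IsGroundStateInSector (hubbardTorus 2 L 1 4) (2 * ⌊(1 - (1 / 6 : ℝ)) * (L : ℝ) ^ 2 / 2⌋₊) 0 ψ ∧
        spinSq *ᵥ ψ = (((⌊(1 - (1 / 6 : ℝ)) * (L : ℝ) ^ 2 / 2⌋₊ : ℝ) *
          ((⌊(1 - (1 / 6 : ℝ)) * (L : ℝ) ^ 2 / 2⌋₊ : ℝ) + 1) : ℝ) : ℂ) • ψ :=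
  not_frequently_saturated_route_box ⟨le_rfl, by norm_num⟩ ⟨by norm_num, by norm_num⟩

end Summit.HubbardSuperconductivity.HubbardSuperconductivity.Theorems.MesoscopicPairOrder.Negative
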